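import Summits.RiemannHypothesis.RiemannHypothesis.Theorems.WeilFormatCTailJointGramPrelim
import HarnessLib

/-!
# Format C, L-C3b joint tail (design "TJ"): block zeta Gram and the assembly of the joint `A/B` majorant

Route context: Fourier–Galerkin / Schur-complement certificates of Weil positivity on a window ("format C";
cell memo `run/shared/lean/pub/rh-explicit/rh-explicit-weil-10/FORMATC-DESIGN.md` §9.9.7; supporting
stmt-RiemannHypothesis-0098; seat rh-explicit-weil-10; lead ruling R8-15 (C)).  The structured part of an order-`J`
tail column is `X_m = (F_m/π)·P_A(m) + P_B(m)` with the mode function `F_m = π/4 + δ_m + S_m` (`|δ_m| ≤ c`, prime sum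
`S_m = Σ_k w_k sin(mθ_k)`) and two polynomials `P_A(m) = Σ_j α_j/m^{e^A_j}`, `P_B(m) = Σ_r β_r/m^{e^B_r}` in `1/m`.
The order-`J` files (`WeilFormatCTailEvenJ`, `…EvenJMS`) split `X_m²` between the two families by Peter–Paul
(`(1+η)`, `(1+η⁻¹)`).  Design "TJ" removes that split: centring the mode function at its mean `π/4`,
`X_m = Q(m) + t_m·P_A(m)` with ONE polynomial `Q = P_A/4 + P_B` over the joint exponent family and the small
perturbation `t_m = (δ_m + S_m)/π`, so that every term of `Σ_m X_m²` has an `N`-UNIFORM one-sided bound.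
This file (algebra and assembly; the estimates are in `WeilFormatCTailJointGramPrelim`):

* `sum_sum_mul_le_of_abs_le` — rectangular weighted AM–GM (`Σ_{j,r} α_jβ_rC_{jr}` against `|C| ≤ r`);
* `sum_Ico_sq_add_sum_div_pow_le` — the explicit `N`-uniform zeta-Gram majorant for a SUM of two families
  (block form of `sum_Ico_sq_sum_div_pow_le`);
* `sum_sq_joint_le` — the assembly: `Σ_m X_m² ≤ (1 + c/π)·Q_J + (c/π + c̄₂/π²)·Q_A + Gershgorin terms`.

Standard axioms; no definitions; no RH claim.
-/

set_option autoImplicit false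
-- `Summit.RiemannHypothesis.RiemannHypothesis.…` is the layout-mandated namespace (summit = problem name).
set_option linter.dupNamespace false

noncomputable section

open Finset
open scoped Real BigOperators

namespace Summit.RiemannHypothesis.RiemannHypothesis.Theorems.WeilFormatC

/-! ## Algebra: rectangular Gershgorin and the block zeta Gram -/

section Algebra

/-- **Rectangular weighted AM–GM.**  If `|C_{jr}| ≤ r_{jr}` and `μ, ν > 0` then
`Σ_jΣ_r α_jβ_rC_{jr} ≤ ½Σ_j α_j²Σ_r r_{jr}ν_r/μ_j + ½Σ_r β_r²Σ_j r_{jr}μ_j/ν_r`. -/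
theorem sum_sum_mul_le_of_abs_le {DA DB : ℕ} (C r : Fin DA → Fin DB → ℝ) (α : Fin DA → ℝ) (β : Fin DB → ℝ)
    (mu : Fin DA → ℝ) (nu : Fin DB → ℝ) (hmu : ∀ j, 0 < mu j) (hnu : ∀ r', 0 < nu r')
    (hC : ∀ j r', |C j r'| ≤ r j r') :
    ∑ j, ∑ r', α j * β r' * C j r'
      ≤ (∑ j, α j ^ 2 * ∑ r', r j r' * nu r' / mu j) / 2 + (∑ r', β r' ^ 2 * ∑ j, r j r' * mu j / nu r') / 2 := by
  have hterm : ∀ j r', α j * β r' * C j r'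
      ≤ r j r' * nu r' / mu j * α j ^ 2 / 2 + r j r' * mu j / nu r' * β r' ^ 2 / 2 := by
    intro j r'
    have h1 : α j * β r' * C j r' ≤ |α j| * |β r'| * r j r' := by
      calc α j * β r' * C j r' ≤ |α j * β r' * C j r'| := le_abs_self _
        _ = |α j| * |β r'| * |C j r'| := by rw [abs_mul, abs_mul]
        _ ≤ |α j| * |β r'| * r j r' := mul_le_mul_of_nonneg_left (hC j r') (by positivity)
    have hr0 : 0 ≤ r j r' := (abs_nonneg _).trans (hC j r')
    have hl := hmu j; have hl' := hnu r'
    have h2 : 2 * (|α j| * |β r'|) ≤ nu r' / mu j * |α j| ^ 2 + mu j / nu r' * |β r'| ^ 2 := by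
      rw [← sub_nonneg]
      have e : nu r' / mu j * |α j| ^ 2 + mu j / nu r' * |β r'| ^ 2 - 2 * (|α j| * |β r'|)
          = (nu r' * |α j| - mu j * |β r'|) ^ 2 / (mu j * nu r') := by
        field_simp
        ring
      rw [e]; positivity
    rw [sq_abs, sq_abs] at h2
    have h3 := mul_le_mul_of_nonneg_left h2 hr0
    have e4 : r j r' * (nu r' / mu j * α j ^ 2 + mu j / nu r' * β r' ^ 2)
        = 2 * (r j r' * nu r' / mu j * α j ^ 2 / 2 + r j r' * mu j / nu r' * β r' ^ 2 / 2) := by ring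
    have e5 : r j r' * (2 * (|α j| * |β r'|)) = 2 * (|α j| * |β r'| * r j r') := by ring
    rw [e4, e5] at h3
    linarith [h1, h3]
  calc ∑ j, ∑ r', α j * β r' * C j r'
      ≤ ∑ j, ∑ r', (r j r' * nu r' / mu j * α j ^ 2 / 2 + r j r' * mu j / nu r' * β r' ^ 2 / 2) :=
        Finset.sum_le_sum fun j _ ↦ Finset.sum_le_sum fun r' _ ↦ hterm j r'
    _ = (∑ j, ∑ r', r j r' * nu r' / mu j * α j ^ 2 / 2) + ∑ j, ∑ r', r j r' * mu j / nu r' * β r' ^ 2 / 2 := by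
        simp only [Finset.sum_add_distrib]
    _ = (∑ j, ∑ r', r j r' * nu r' / mu j * α j ^ 2 / 2) + ∑ r', ∑ j, r j r' * mu j / nu r' * β r' ^ 2 / 2 := by
        congr 1
        exact Finset.sum_comm
    _ = _ := by
        rw [Finset.sum_div, Finset.sum_div]
        congr 1
        · refine Finset.sum_congr rfl fun j _ ↦ ?_
          rw [Finset.mul_sum, Finset.sum_div]
          exact Finset.sum_congr rfl fun r' _ ↦ by ring
        · refine Finset.sum_congr rfl fun r' _ ↦ ?_
          rw [Finset.mul_sum, Finset.sum_div]
          exact Finset.sum_congr rfl fun j _ ↦ by ring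

/-- **The explicit `N`-uniform zeta-Gram majorant for a sum of two families** (block form of
`sum_Ico_sq_sum_div_pow_le`, obtained from it on the appended family): for `2 ≤ B₃`, exponents `e^A_j, e^B_r ≥ 1`,
positive weights `μ_j, ν_r`, every `N`, `α`, `β`, with `hi(e) = 1/((e−1)(B₃−1)^{e−1})`, `lo(e) = 1/((e−1)B₃^{e−1})`:
`Σ_{m∈Ico B₃ N} (Σ_j α_j/m^{e^A_j} + Σ_r β_r/m^{e^B_r})²` is at most the four-block `(hi+lo)/2` form plus the weighted
Gershgorin diagonal of the radii `(hi−lo)/2` across both families. -/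
theorem sum_Ico_sq_add_sum_div_pow_le {DA DB : ℕ} (eA : Fin DA → ℕ) (eB : Fin DB → ℕ) (heA : ∀ j, 1 ≤ eA j)
    (heB : ∀ r', 1 ≤ eB r') {B₃ : ℕ} (hB₃ : 2 ≤ B₃) (mu : Fin DA → ℝ) (nu : Fin DB → ℝ) (hmu : ∀ j, 0 < mu j)
    (hnu : ∀ r', 0 < nu r') (N : ℕ) (α : Fin DA → ℝ) (β : Fin DB → ℝ) :
    ∑ m ∈ Finset.Ico B₃ N, ((∑ j, α j / (m : ℝ) ^ eA j) + ∑ r', β r' / (m : ℝ) ^ eB r') ^ 2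
      ≤ (((∑ j, ∑ j', α j * α j' * ((1 / ((eA j + eA j' - 1 : ℕ) * (((B₃ - 1 : ℕ) : ℝ)) ^ (eA j + eA j' - 1)) + 1 / ((eA j + eA j' - 1 : ℕ) * (B₃ : ℝ) ^ (eA j + eA j' - 1))) / 2))
            + ∑ r', ∑ j, β r' * α j * ((1 / ((eB r' + eA j - 1 : ℕ) * (((B₃ - 1 : ℕ) : ℝ)) ^ (eB r' + eA j - 1)) + 1 / ((eB r' + eA j - 1 : ℕ) * (B₃ : ℝ) ^ (eB r' + eA j - 1))) / 2))
          + ((∑ j, ∑ r', α j * β r' * ((1 / ((eA j + eB r' - 1 : ℕ) * (((B₃ - 1 : ℕ) : ℝ)) ^ (eA j + eB r' - 1)) + 1 / ((eA j + eB r' - 1 : ℕ) * (B₃ : ℝ) ^ (eA j + eB r' - 1))) / 2))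
            + ∑ r', ∑ r'', β r' * β r'' * ((1 / ((eB r' + eB r'' - 1 : ℕ) * (((B₃ - 1 : ℕ) : ℝ)) ^ (eB r' + eB r'' - 1)) + 1 / ((eB r' + eB r'' - 1 : ℕ) * (B₃ : ℝ) ^ (eB r' + eB r'' - 1))) / 2)))
        + (((∑ j, α j ^ 2 * ∑ j', ((1 / ((eA j + eA j' - 1 : ℕ) * (((B₃ - 1 : ℕ) : ℝ)) ^ (eA j + eA j' - 1)) - 1 / ((eA j + eA j' - 1 : ℕ) * (B₃ : ℝ) ^ (eA j + eA j' - 1))) / 2) * mu j' / mu j)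
            + ∑ r', β r' ^ 2 * ∑ j, ((1 / ((eB r' + eA j - 1 : ℕ) * (((B₃ - 1 : ℕ) : ℝ)) ^ (eB r' + eA j - 1)) - 1 / ((eB r' + eA j - 1 : ℕ) * (B₃ : ℝ) ^ (eB r' + eA j - 1))) / 2) * mu j / nu r')
          + ((∑ j, α j ^ 2 * ∑ r', ((1 / ((eA j + eB r' - 1 : ℕ) * (((B₃ - 1 : ℕ) : ℝ)) ^ (eA j + eB r' - 1)) - 1 / ((eA j + eB r' - 1 : ℕ) * (B₃ : ℝ) ^ (eA j + eB r' - 1))) / 2) * nu r' / mu j)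
            + ∑ r', β r' ^ 2 * ∑ r'', ((1 / ((eB r' + eB r'' - 1 : ℕ) * (((B₃ - 1 : ℕ) : ℝ)) ^ (eB r' + eB r'' - 1)) - 1 / ((eB r' + eB r'' - 1 : ℕ) * (B₃ : ℝ) ^ (eB r' + eB r'' - 1))) / 2) * nu r'' / nu r')) := by
  have h := sum_Ico_sq_sum_div_pow_le (D := DA + DB) (Fin.append eA eB)
    (fun p ↦ by
      refine Fin.addCases (fun j ↦ ?_) (fun r' ↦ ?_) p
      · simp only [Fin.append_left]; exact heA j
      · simp only [Fin.append_right]; exact heB r')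
    hB₃ (Fin.append mu nu)
    (fun p ↦ by
      refine Fin.addCases (fun j ↦ ?_) (fun r' ↦ ?_) p
      · simp only [Fin.append_left]; exact hmu j
      · simp only [Fin.append_right]; exact hnu r')
    N (Fin.append α β)
  simp only [Fin.sum_univ_add, Fin.append_left, Fin.append_right, Finset.sum_add_distrib, mul_add] at h
  exact h

end Algebra

/-! ## Assembly of the joint majorant -/

section Assembly

/-- **Assembly of the joint `A/B` Gram bound.**  Per mode `X_m = ((π/4 + δ_m + S_m)/π)·P_A(m) + P_B(m)` with
`|δ_m| ≤ c`, a centred mean-square bound `(δ_m + S_m)² ≤ c̄₂ + osc₂(m)` (`c̄₂ ≥ 0`), bounds `Q_J ≥ Σ_m (P_A/4 + P_B)²`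
and `Q_A ≥ Σ_m P_A²`, entrywise bounds `ρ` (symmetric) for the pair-oscillation Gram `Σ_m osc₂(m)/m^{e^A_j+e^A_{j'}}`,
`r^A` (symmetric) and `r^X` for the prime-sum moments `Σ_m S_m/m^{e^A_j+e^A_{j'}}`, `Σ_m S_m/m^{e^A_j+e^B_r}`, and
positive weights `μ, ν`:
`Σ_m X_m² ≤ (1 + c/π)Q_J + (c/π + c̄₂/π²)Q_A + π⁻²Σ_j α_j²Σ_{j'}ρ_{jj'}μ_{j'}/μ_j + (2π)⁻¹Σ_j α_j²Σ_{j'}r^A_{jj'}μ_{j'}/μ_j`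
`+ π⁻¹(Σ_j α_j²Σ_r r^X_{jr}ν_r/μ_j + Σ_r β_r²Σ_j r^X_{jr}μ_j/ν_r)`. -/
theorem sum_sq_joint_le (T : Finset ℕ) (δ S oscP : ℕ → ℝ) {c cbar : ℝ} (hc : 0 ≤ c) (hcbar : 0 ≤ cbar)
    (hδ : ∀ m ∈ T, |δ m| ≤ c) (hmode : ∀ m ∈ T, (δ m + S m) ^ 2 ≤ cbar + oscP m)
    {DA DB : ℕ} (eA : Fin DA → ℕ) (eB : Fin DB → ℕ) (α : Fin DA → ℝ) (β : Fin DB → ℝ)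
    (mu : Fin DA → ℝ) (nu : Fin DB → ℝ) (hmu : ∀ j, 0 < mu j) (hnu : ∀ r', 0 < nu r')
    {QJ QA : ℝ}
    (hQJ : ∑ m ∈ T, ((∑ j, α j / 4 / (m : ℝ) ^ eA j) + ∑ r', β r' / (m : ℝ) ^ eB r') ^ 2 ≤ QJ)
    (hQA : ∑ m ∈ T, (∑ j, α j / (m : ℝ) ^ eA j) ^ 2 ≤ QA)
    (ρ rA : Fin DA → Fin DA → ℝ) (rX : Fin DA → Fin DB → ℝ)
    (hρ : ∀ j j', |∑ m ∈ T, oscP m * (1 / (m : ℝ) ^ (eA j + eA j'))| ≤ ρ j j') (hρs : ∀ j j', ρ j j' = ρ j' j)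
    (hrA : ∀ j j', |∑ m ∈ T, S m * (1 / (m : ℝ) ^ (eA j + eA j'))| ≤ rA j j') (hrAs : ∀ j j', rA j j' = rA j' j)
    (hrX : ∀ j r', |∑ m ∈ T, S m * (1 / (m : ℝ) ^ (eA j + eB r'))| ≤ rX j r') :
    ∑ m ∈ T, ((π / 4 + δ m + S m) / π * (∑ j, α j / (m : ℝ) ^ eA j) + ∑ r', β r' / (m : ℝ) ^ eB r') ^ 2
      ≤ (1 + c / π) * QJ + (c / π + cbar / π ^ 2) * QA
        + (1 / π ^ 2) * ∑ j, α j ^ 2 * ∑ j', ρ j j' * mu j' / mu j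
        + (1 / (2 * π)) * ∑ j, α j ^ 2 * ∑ j', rA j j' * mu j' / mu j
        + (1 / π) * ((∑ j, α j ^ 2 * ∑ r', rX j r' * nu r' / mu j) + ∑ r', β r' ^ 2 * ∑ j, rX j r' * mu j / nu r') := by
  set PA : ℕ → ℝ := fun m ↦ ∑ j, α j / (m : ℝ) ^ eA j with hPA
  set PB : ℕ → ℝ := fun m ↦ ∑ r', β r' / (m : ℝ) ^ eB r' with hPB
  set Q : ℕ → ℝ := fun m ↦ (∑ j, α j / 4 / (m : ℝ) ^ eA j) + PB m with hQ
  have hQ' : ∀ m, Q m = PA m / 4 + PB m := by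
    intro m
    simp only [hQ, hPA, Finset.sum_div]
    congr 1
    exact Finset.sum_congr rfl fun j _ ↦ by ring
  -- per-mode split
  have hmode' : ∀ m ∈ T, ((π / 4 + δ m + S m) / π * PA m + PB m) ^ 2
      ≤ (1 + c / π) * Q m ^ 2 + c / π * PA m ^ 2 + (1 / π ^ 2) * ((δ m + S m) ^ 2 * PA m ^ 2)
        + (1 / (2 * π)) * (S m * PA m ^ 2) + (2 / π) * (S m * (PA m * PB m)) := by
    intro m hm
    have hX : (π / 4 + δ m + S m) / π * PA m + PB m = Q m + (δ m + S m) / π * PA m := by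
      rw [hQ' m]; field_simp; ring
    rw [hX]
    have hcr : 2 * (δ m / π * (Q m * PA m)) ≤ c / π * (Q m ^ 2 + PA m ^ 2) := by
      have h1 : |2 * (δ m / π * (Q m * PA m))| ≤ c / π * (Q m ^ 2 + PA m ^ 2) := by
        rw [abs_mul, abs_mul, abs_of_pos (by norm_num : (0 : ℝ) < 2), abs_div, abs_of_pos Real.pi_pos, abs_mul]
        have h2 : 2 * (|Q m| * |PA m|) ≤ Q m ^ 2 + PA m ^ 2 := by
          rw [← sq_abs (Q m), ← sq_abs (PA m)]; nlinarith [sq_nonneg (|Q m| - |PA m|)]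
        have h3 : |δ m| / π ≤ c / π := div_le_div_of_nonneg_right (hδ m hm) Real.pi_pos.le
        have h4 : 0 ≤ |δ m| / π := by positivity
        nlinarith [h2, h3, h4, abs_nonneg (Q m), abs_nonneg (PA m)]
      exact (le_abs_self _).trans h1
    have e1 : (Q m + (δ m + S m) / π * PA m) ^ 2
        = Q m ^ 2 + 2 * (δ m / π * (Q m * PA m)) + (2 / π) * (S m * (Q m * PA m))
          + (1 / π ^ 2) * ((δ m + S m) ^ 2 * PA m ^ 2) := by
      field_simp
      ring
    have e2 : S m * (Q m * PA m) = (S m * PA m ^ 2) / 4 + S m * (PA m * PB m) := by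
      rw [hQ' m]; ring
    rw [e1]
    have step : Q m ^ 2 + 2 * (δ m / π * (Q m * PA m)) + 2 / π * (S m * (Q m * PA m))
          + 1 / π ^ 2 * ((δ m + S m) ^ 2 * PA m ^ 2)
        ≤ Q m ^ 2 + c / π * (Q m ^ 2 + PA m ^ 2) + 2 / π * (S m * (Q m * PA m))
          + 1 / π ^ 2 * ((δ m + S m) ^ 2 * PA m ^ 2) := by
      linarith [hcr]
    refine step.trans (le_of_eq ?_)
    rw [e2]
    ring
  -- sum over the modes
  have hsum1 : ∑ m ∈ T, ((π / 4 + δ m + S m) / π * PA m + PB m) ^ 2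
      ≤ (1 + c / π) * ∑ m ∈ T, Q m ^ 2 + c / π * ∑ m ∈ T, PA m ^ 2
        + (1 / π ^ 2) * ∑ m ∈ T, (δ m + S m) ^ 2 * PA m ^ 2
        + (1 / (2 * π)) * ∑ m ∈ T, S m * PA m ^ 2 + (2 / π) * ∑ m ∈ T, S m * (PA m * PB m) := by
    refine (Finset.sum_le_sum hmode').trans (le_of_eq ?_)
    simp only [Finset.sum_add_distrib, ← Finset.mul_sum]
  -- (i) the joint zeta form and (ii) the A form
  have hQJ' : ∑ m ∈ T, Q m ^ 2 ≤ QJ := hQJ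
  have hQA' : ∑ m ∈ T, PA m ^ 2 ≤ QA := hQA
  -- (iii) the centred mean-square term
  have hMS : ∑ m ∈ T, (δ m + S m) ^ 2 * PA m ^ 2 ≤ cbar * QA + ∑ j, α j ^ 2 * ∑ j', ρ j j' * mu j' / mu j :=
    sum_sq_mul_sq_le_of_mode_bounds T (fun m ↦ δ m + S m) oscP hcbar eA α mu hmu hmode hQA ρ hρ hρs
  -- (iv) the single-frequency term on the A family
  set XA : Fin DA → Fin DA → ℝ := fun j j' ↦ ∑ m ∈ T, S m * (1 / (m : ℝ) ^ (eA j + eA j')) with hXA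
  have hSA : ∑ m ∈ T, S m * PA m ^ 2 = ∑ j, ∑ j', α j * α j' * XA j j' := by
    have hexp : ∀ m ∈ T, S m * PA m ^ 2 = ∑ j, ∑ j', α j * α j' * (S m * (1 / (m : ℝ) ^ (eA j + eA j'))) := by
      intro m _
      simp only [hPA]
      rw [sq, Finset.sum_mul_sum, Finset.mul_sum]
      refine Finset.sum_congr rfl fun j _ ↦ ?_
      rw [Finset.mul_sum]
      refine Finset.sum_congr rfl fun j' _ ↦ ?_
      rw [pow_add]
      ring
    rw [Finset.sum_congr rfl hexp, Finset.sum_comm]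
    refine Finset.sum_congr rfl fun j _ ↦ ?_
    rw [Finset.sum_comm]
    refine Finset.sum_congr rfl fun j' _ ↦ ?_
    rw [hXA, Finset.mul_sum]
  have hXAle : ∀ j j', |XA j j' - 0| ≤ rA j j' := fun j j' ↦ by rw [sub_zero]; exact hrA j j'
  have hgA := gram_le_mid_add_gershgorin XA (fun _ _ ↦ (0 : ℝ)) rA mu α hmu hXAle hrAs
  simp only [mul_zero, Finset.sum_const_zero, zero_add] at hgA
  rw [← hSA] at hgA
  -- (v) the single-frequency cross term
  set XC : Fin DA → Fin DB → ℝ := fun j r' ↦ ∑ m ∈ T, S m * (1 / (m : ℝ) ^ (eA j + eB r')) with hXC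
  have hSC : ∑ m ∈ T, S m * (PA m * PB m) = ∑ j, ∑ r', α j * β r' * XC j r' := by
    have hexp : ∀ m ∈ T, S m * (PA m * PB m) = ∑ j, ∑ r', α j * β r' * (S m * (1 / (m : ℝ) ^ (eA j + eB r'))) := by
      intro m _
      simp only [hPA, hPB]
      rw [Finset.sum_mul_sum, Finset.mul_sum]
      refine Finset.sum_congr rfl fun j _ ↦ ?_
      rw [Finset.mul_sum]
      refine Finset.sum_congr rfl fun r' _ ↦ ?_
      rw [pow_add]
      field_simp
    rw [Finset.sum_congr rfl hexp, Finset.sum_comm]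
    refine Finset.sum_congr rfl fun j _ ↦ ?_
    rw [Finset.sum_comm]
    refine Finset.sum_congr rfl fun r' _ ↦ ?_
    rw [hXC, Finset.mul_sum]
  have hgC := sum_sum_mul_le_of_abs_le XC rX α β mu nu hmu hnu hrX
  rw [← hSC] at hgC
  -- collect
  have hcπ : 0 ≤ 1 + c / π := by positivity
  have hcπ' : 0 ≤ c / π := by positivity
  have hπ2 : 0 ≤ 1 / π ^ 2 := by positivity
  have hπ1 : 0 ≤ 1 / (2 * π) := by positivity
  have hπ3 : 0 ≤ 2 / π := by positivity
  have step := add_le_add (add_le_add (add_le_add (add_le_add (mul_le_mul_of_nonneg_left hQJ' hcπ)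
    (mul_le_mul_of_nonneg_left hQA' hcπ')) (mul_le_mul_of_nonneg_left hMS hπ2))
    (mul_le_mul_of_nonneg_left hgA hπ1)) (mul_le_mul_of_nonneg_left hgC hπ3)
  refine (hsum1.trans step).trans (le_of_eq ?_)
  ring

end Assembly

end Summit.RiemannHypothesis.RiemannHypothesis.Theorems.WeilFormatC

end
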